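import Mathlib

/-!
# SpinTensor — the D₄ weight certificate behind the Kuga–Satake placement (solo-blind s46)

For the rank-8 transcendental lattice `T ≅ ⟨1,1,−1⁶⟩` of the T₈ face the even Clifford algebra
splits, `C₊(T) = E₊ × E₋`, and the Kuga–Satake variety is isogenous to `A₊⁴ × A₋⁴` with
`H¹(A±) = S±` the two half-spin representations of `𝔰𝔬₈`.  The question "on which product
`X × A_• × A_•` does the Kuga–Satake Hodge class live" is the question in which tensor products
of half-spin representations the vector representation `V` occurs.  This file certifies, at the
level of weight multisets (weights scaled by 2 so that they are integral; all proofs by `decide` /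
`decide +kernel`, no `native_decide`, no extra axioms):

* `sp_sp_avoids_V`, `sm_sm_avoids_V`: no weight of `V` is a weight of `S₊ ⊗ S₊` or of `S₋ ⊗ S₋`
  (indeed all weights of `S± ⊗ S±` lie in the root-lattice coset, those of `V` do not), so `V`
  is not a subrepresentation of `S₊ ⊗ S₊` or `S₋ ⊗ S₋`;
* `sp_sm_perm`: the weight multiset of `S₊ ⊗ S₋` is exactly `wt(V) ⊎ wt(Λ³V)`, the character
  identity `S₊ ⊗ S₋ ≅ V ⊕ Λ³V`.

Consequence used on paper (HOME `work/s46/q8-face.md` §5, claim SB-C371): at a Hodge-generic point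
of the face the Kuga–Satake class lies in `T ⊗ H¹(A₊) ⊗ H¹(A₋)`, i.e. on `X × A₊ × A₋`, never on
`X × A₊ × A₊` — correcting the last clause of SB-C366.  Only the finite weight computation is
formalised; the representation theory it certifies (weights of a subrepresentation form a
sub-multiset; characters determine representations) stays on paper.
-/

namespace Summit.HodgeConjecture.HodgeConjecture.Theorems.SpinTensor

/-- A weight of `D₄`, written in the standard basis `e₁,…,e₄` and scaled by `2`. -/
abbrev Wt := ℤ × ℤ × ℤ × ℤ

/-- Sum of two weights (the weights of a tensor product are the pairwise sums). -/
def add (a b : Wt) : Wt := (a.1 + b.1, a.2.1 + b.2.1, a.2.2.1 + b.2.2.1, a.2.2.2 + b.2.2.2)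

/-- Weights of the vector representation `V` (dimension 8): `±2eᵢ`. -/
def wtV : List Wt :=
  [(2,0,0,0), (-2,0,0,0), (0,2,0,0), (0,-2,0,0), (0,0,2,0), (0,0,-2,0), (0,0,0,2), (0,0,0,-2)]

/-- All sign vectors `(±1,±1,±1,±1)` (= twice the spin weights `(±½,…,±½)`). -/
def spinAll : List Wt := do
  let a ← [1, -1]; let b ← [1, -1]; let c ← [1, -1]; let d ← [1, -1]
  pure (a, b, c, d)

/-- Number of negative coordinates. -/
def numNeg (w : Wt) : ℕ :=
  (if w.1 < 0 then 1 else 0) + (if w.2.1 < 0 then 1 else 0) +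
    (if w.2.2.1 < 0 then 1 else 0) + (if w.2.2.2 < 0 then 1 else 0)

/-- Weights of the half-spin representation `S₊` (even number of minus signs; dimension 8). -/
def wtSp : List Wt := spinAll.filter fun w => numNeg w % 2 = 0

/-- Weights of the half-spin representation `S₋` (odd number of minus signs; dimension 8). -/
def wtSm : List Wt := spinAll.filter fun w => numNeg w % 2 = 1

/-- Weight multiset of a tensor product. -/
def tensor (l m : List Wt) : List Wt := do
  let a ← l; let b ← m
  pure (add a b)

/-- Weights of `Λ³V`: sums over 3-element subsets of the weight basis of `V` (dimension 56). -/
def wtL3V : List Wt :=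
  ((List.range 8).flatMap fun i => (List.range 8).flatMap fun j => (List.range 8).flatMap fun k =>
    if i < j ∧ j < k then [add (add (wtV.getD i 0) (wtV.getD j 0)) (wtV.getD k 0)] else [])

/-- `dim V = 8`. -/
theorem card_wtV : wtV.length = 8 := by decide
/-- `dim S₊ = 8`. -/
theorem card_wtSp : wtSp.length = 8 := by decide
/-- `dim S₋ = 8`. -/
theorem card_wtSm : wtSm.length = 8 := by decide
/-- `dim Λ³V = 56`. -/
theorem card_wtL3V : wtL3V.length = 56 := by decide +kernel
/-- `dim (S₊ ⊗ S₋) = 64`. -/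
theorem card_sp_sm : (tensor wtSp wtSm).length = 64 := by decide +kernel

/-- No weight of `V` occurs among the weights of `S₊ ⊗ S₊`; hence `V ⊄ S₊ ⊗ S₊`. -/
theorem sp_sp_avoids_V : ∀ w ∈ tensor wtSp wtSp, w ∉ wtV := by decide +kernel

/-- No weight of `V` occurs among the weights of `S₋ ⊗ S₋`; hence `V ⊄ S₋ ⊗ S₋`. -/
theorem sm_sm_avoids_V : ∀ w ∈ tensor wtSm wtSm, w ∉ wtV := by decide +kernel

/-- Root-lattice coset version: every weight of `S± ⊗ S±` has all coordinates even and coordinate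
sum `≡ 0 (mod 4)` (the class of the root lattice `Q(D₄)` after scaling by 2), whereas every weight
of `V` has coordinate sum `≡ 2 (mod 4)`. -/
theorem coset_separation :
    (∀ w ∈ tensor wtSp wtSp ++ tensor wtSm wtSm,
        (w.1 + w.2.1 + w.2.2.1 + w.2.2.2) % 4 = 0) ∧
      (∀ w ∈ wtV, (w.1 + w.2.1 + w.2.2.1 + w.2.2.2) % 4 = 2) := by
  constructor <;> decide +kernel

/-- The character identity `S₊ ⊗ S₋ ≅ V ⊕ Λ³V` at the level of weight multisets. -/
theorem sp_sm_perm : (tensor wtSp wtSm).Perm (wtV ++ wtL3V) := by decide +kernel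

/-- In particular every weight of `V` IS a weight of `S₊ ⊗ S₋`. -/
theorem V_sub_sp_sm : ∀ w ∈ wtV, w ∈ tensor wtSp wtSm := by decide +kernel

end Summit.HodgeConjecture.HodgeConjecture.Theorems.SpinTensor
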